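import Summits.MatrixMultiplication.OmegaCensus.PhaseArcCount

/-!
# ω-census, family (b3): conjecture C9 on the Frobenius family — Layer 5a: the dihedral-type box, symbolic phase shifts and the CLASS CHECK

HONEST FRAMING (pub-omega census; verbatim): lottery ticket; floor = certified bounds/negative ranges.
Census BOOKKEEPING (conjecture C9 of the cell; pub-omega stpp-1 gen 21).  Layer 5 of the uniform construction for the Frobenius
groups `ℤ/p ⋊_u ℤ/3` (design note HOME/pub-omega-stpp-1-g20/UNIFORM-FROBENIUS-DESIGN.md; Layers 1–4 = `PhaseArcs`,
`PhaseArcPatterns`, `PhaseArcCount`, `PhaseArcThue`).  All boxes of the construction have the DIHEDRAL TYPE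
`Y = {1, a^α, b}`, `W = {1, a^β, b^t}` (`dbox α β t`), `β = (m + n u)·α`; the phase/error data are supported on the middle
column (`col`).  For such a box the phase shift `PhiOf` and the error `EOf` of `PhaseArcPatterns` are ONE `ℤ`-linear expression
`lin t a b c c'` in the phases `a, b` (resp. errors `e, f`) of `u^s α`, `u^s β` (`phiOf_dbox`, `eOf_dbox`), which commutes
with additive maps (`map_lin`, used to read `Φ mod 8` off the residues of the phases) and is linear (`linE`, used to write
`E = Σ_k M_k e_k` with explicit integer coefficients `Mco`).  Since `e₀ + e₁ + e₂ = 0` one may shift the coefficients by their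
median: `|E| ≤ Sred · ε` (`abs_E_le`) with `Sred = Σ_k |M_k − med|` and `ε = max |e_k|`.  CLASS DATA (`ClassData`): `κ = (m, n)`,
`t`, an 8-phase pattern `P` and trim COEFFICIENTS `clo, chi` (trims `= coefficient · ε`).  CLASS CHECK (`ClassOK γ cd`, decidable,
`γ : ZMod 3 → ZMod 8` the residues of the phases of `α, uα, u²α`): norm of `κ` in `(0, 4]`, `t ≠ 0`, phases in `[0,8)`, `Sred ≤ 3`,
and for every ordered pair of columns and phases the three conditions of `PairOK` with `Φ` replaced by the residue computation
`Φ̄ = lin t γ (mγ + nγ(·+1))` in `ZMod 8` and `|E|` replaced by its bound `Sred·ε`; plus the count envelope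
(`MIS = 16, Σt ≤ 24` or `MIS = 17, Σt ≤ 29`).  The generic theorem turning a passed class check into `¬ BoxUseful` is in
`PhaseArcClassMain.lean`.  Nothing here is progress on `ω`.
-/

namespace Summit.MatrixMultiplication.OmegaCensus

open Finset

namespace PhaseArcs

variable {p : ℕ}

/-! ### The dihedral-type box and the linear expression `lin` -/

/-- The dihedral-type box `Y = {1, a^α, b}`, `W = {1, a^β, b^t}` of `ℤ/p ⋊_u ℤ/3`. [folklore] -/
def dbox (α β : ZMod p) (t : ZMod 3) : MetaCyc.ABox p 3 := ⟨![0, α, 0], ![0, 0, 1], ![0, β, 0], ![0, 0, t]⟩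

/-- Data supported on the middle `Y`/`W`-element: `col a s i = a s` if `i = 1`, else `0`. [folklore] -/
def col {R : Type*} [Zero R] (a : ZMod 3 → R) : ZMod 3 → Fin 3 → R := fun s i => if i = 1 then a s else 0

/-- The common shape of `PhiOf` / `EOf` for a dihedral-type box with `W`-exponent `t`:
`a(s₁)·[i'=1] − b(s₁)·[j=1] + b(s₂)·[j'=1] − a(s₃)·[i=1]`, `s₁ = a_i + t b_{j'}`, `s₂ = a_i + t b_j`, `s₃ = a_{i'} + t b_{j'}`
with `Y`-levels `(0,0,1)` and `W`-levels `(0,0,t)`. [folklore] -/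
def lin {R : Type*} [AddCommGroup R] (t : ZMod 3) (a b : ZMod 3 → R) (c c' : Fin 3 × Fin 3) : R :=
  col a ((![0, 0, 1] : Fin 3 → ZMod 3) c.1 + (![0, 0, t] : Fin 3 → ZMod 3) c'.2) c'.1
    - col b ((![0, 0, 1] : Fin 3 → ZMod 3) c.1 + (![0, 0, t] : Fin 3 → ZMod 3) c'.2) c.2
    + col b ((![0, 0, 1] : Fin 3 → ZMod 3) c.1 + (![0, 0, t] : Fin 3 → ZMod 3) c.2) c'.2
    - col a ((![0, 0, 1] : Fin 3 → ZMod 3) c'.1 + (![0, 0, t] : Fin 3 → ZMod 3) c'.2) c.1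

/-- `PhiOf` of a dihedral-type box is `lin`. [folklore] -/
theorem phiOf_dbox (α β : ZMod p) (t : ZMod 3) (a b : ZMod 3 → ℤ) (c c' : Fin 3 × Fin 3) :
    PhiOf (dbox α β t) (col a) (col b) c c' = lin t a b c c' := rfl

/-- `EOf` of a dihedral-type box is `lin`. [folklore] -/
theorem eOf_dbox (α β : ZMod p) (t : ZMod 3) (e f : ZMod 3 → ℤ) (c c' : Fin 3 × Fin 3) :
    EOf (dbox α β t) (col e) (col f) c c' = lin t e f c c' := rfl

/-- `lin` commutes with additive maps (used with `ℤ → ZMod 8`). [folklore] -/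
theorem map_lin {R S : Type*} [AddCommGroup R] [AddCommGroup S] (g : R →+ S) (t : ZMod 3) (a b : ZMod 3 → R)
    (c c' : Fin 3 × Fin 3) : g (lin t a b c c') = lin t (g ∘ a) (g ∘ b) c c' := by
  simp only [lin, col, map_sub, map_add, Function.comp_apply]
  split_ifs <;> simp only [map_zero]

/-- The error functional `e ↦ lin t e (m e + n e(·+1))` as an additive map. [folklore] -/
def linE (t : ZMod 3) (m n : ℤ) (c c' : Fin 3 × Fin 3) : (ZMod 3 → ℤ) →+ ℤ where
  toFun e := lin t e (fun s => m * e s + n * e (s + 1)) c c'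
  map_zero' := by simp only [lin, col, Pi.zero_apply, mul_zero, add_zero]; split_ifs <;> simp
  map_add' e e' := by
    simp only [lin, col, Pi.add_apply]
    split_ifs <;> ring

/-- The coefficient of `e_k` in the error: `M_k = linE (δ_k)`. [folklore] -/
def Mco (t : ZMod 3) (m n : ℤ) (c c' : Fin 3 × Fin 3) (k : ZMod 3) : ℤ :=
  lin t (Pi.single k (1 : ℤ) : ZMod 3 → ℤ)
    (fun s => m * (Pi.single k (1 : ℤ) : ZMod 3 → ℤ) s + n * (Pi.single k (1 : ℤ) : ZMod 3 → ℤ) (s + 1)) c c'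

/-- `linE` on a basis vector is `Mco`. [folklore] -/
theorem linE_single (t : ZMod 3) (m n : ℤ) (c c' : Fin 3 × Fin 3) (k : ZMod 3) :
    linE t m n c c' (Pi.single k (1 : ℤ)) = Mco t m n c c' k := rfl

/-- **`E = Σ_k M_k e_k`.** [folklore] -/
theorem linE_eq_sum (t : ZMod 3) (m n : ℤ) (c c' : Fin 3 × Fin 3) (e : ZMod 3 → ℤ) :
    linE t m n c c' e = ∑ k, Mco t m n c c' k * e k := by
  conv_lhs => rw [← Finset.univ_sum_single e]
  rw [map_sum]
  refine Finset.sum_congr rfl fun k _ => ?_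
  have : Pi.single k (e k) = e k • (Pi.single k (1 : ℤ) : ZMod 3 → ℤ) := by
    ext s; simp only [Pi.smul_apply, smul_eq_mul, Pi.single_apply]; split_ifs <;> simp
  rw [this, map_zsmul, linE_single, smul_eq_mul, mul_comm]

/-- The median of three integers. [folklore] -/
def med3 (x y z : ℤ) : ℤ := max (min x y) (min (max x y) z)

/-- The reduced coefficient sum `Sred = Σ_k |M_k − med(M)|` (a bound `|E| ≤ Sred · max|e_k|` when `Σ e_k = 0`). [folklore] -/
def Sred (t : ZMod 3) (m n : ℤ) (c c' : Fin 3 × Fin 3) : ℤ :=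
  ∑ k, |Mco t m n c c' k - med3 (Mco t m n c c' 0) (Mco t m n c c' 1) (Mco t m n c c' 2)|

/-- **The error bound** `|E| ≤ Sred · ε` when `e₀ + e₁ + e₂ = 0` and `|e_k| ≤ ε`. [folklore] -/
theorem abs_E_le (t : ZMod 3) (m n : ℤ) (c c' : Fin 3 × Fin 3) (e : ZMod 3 → ℤ) (hsum : ∑ k, e k = 0) (ε : ℤ)
    (hε : ∀ k, |e k| ≤ ε) : |lin t e (fun s => m * e s + n * e (s + 1)) c c'| ≤ Sred t m n c c' * ε := by
  set r := med3 (Mco t m n c c' 0) (Mco t m n c c' 1) (Mco t m n c c' 2)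
  have h1 : lin t e (fun s => m * e s + n * e (s + 1)) c c' = ∑ k, (Mco t m n c c' k - r) * e k := by
    change linE t m n c c' e = _
    rw [linE_eq_sum]
    simp only [sub_mul, Finset.sum_sub_distrib, ← Finset.mul_sum, hsum, mul_zero, sub_zero]
  rw [h1, Sred, Finset.sum_mul]
  refine (Finset.abs_sum_le_sum_abs _ _).trans (Finset.sum_le_sum fun k _ => ?_)
  rw [abs_mul]
  exact mul_le_mul_of_nonneg_left (hε k) (abs_nonneg _)

/-! ### Class data and the decidable class check -/

/-- A trim table as an association list `(column, phase, coefficient)`; absent entries are `0`. [folklore] -/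
def trimOf : List ((Fin 3 × Fin 3) × ℤ × ℕ) → Fin 3 × Fin 3 → ℤ → ℕ
  | [], _, _ => 0
  | (c', φ', v) :: L, c, φ => if c' = c ∧ φ' = φ then v else trimOf L c φ

/-- Class data: `β = (m + n u) α`, `W`-exponent `t`, the phase pattern `P` and the trim coefficient tables. [folklore] -/
structure ClassData where
  /-- `κ = m + n u` -/
  m : ℤ
  /-- `κ = m + n u` -/
  n : ℤ
  /-- the `b`-exponent of the third `W`-element -/
  t : ZMod 3
  /-- phases used per column (a subset of `[0, 8)`) -/
  P : Fin 3 × Fin 3 → Finset ℤ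
  /-- bottom-trim coefficients -/
  clo : Fin 3 × Fin 3 → ℤ → ℕ
  /-- top-trim coefficients -/
  chi : Fin 3 × Fin 3 → ℤ → ℕ

namespace ClassData

variable (cd : ClassData)

/-- Number of phase blocks used: `Σ_c #P(c)`. [folklore] -/
def MIS : ℕ := ∑ c, #(cd.P c)

/-- Total trim coefficient `Σ_c Σ_{φ ∈ P c} (clo + chi)`. [folklore] -/
def SigT : ℕ := ∑ c, ∑ φ ∈ cd.P c, (cd.clo c φ + cd.chi c φ)

/-- The residue phase shift `Φ̄(c,c') ∈ ZMod 8` computed from the residues `γ` of the phases of `u^s α`. [folklore] -/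
def PhiBar (γ : ZMod 3 → ZMod 8) (c c' : Fin 3 × Fin 3) : ZMod 8 :=
  lin cd.t γ (fun s => (cd.m : ZMod 8) * γ s + (cd.n : ZMod 8) * γ (s + 1)) c c'

/-- The pair condition of the class check (residue form of `PairOK`, `|E|` replaced by `Sred`). [folklore] -/
def PairBar (γ : ZMod 3 → ZMod 8) (c c' : Fin 3 × Fin 3) (φ φ' : ℤ) : Prop :=
  (φ - φ' - ((cd.PhiBar γ c c').val : ℤ)) % 8 ≠ 0 ∧
    ((φ - φ' - ((cd.PhiBar γ c c').val : ℤ) - 1) % 8 = 0 →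
      Sred cd.t cd.m cd.n c c' ≤ cd.chi c' φ' ∨ Sred cd.t cd.m cd.n c c' ≤ cd.clo c φ) ∧
    ((φ - φ' - ((cd.PhiBar γ c c').val : ℤ) + 1) % 8 = 0 →
      Sred cd.t cd.m cd.n c c' ≤ cd.clo c' φ' ∨ Sred cd.t cd.m cd.n c c' ≤ cd.chi c φ)

/-- `PairBar` is decidable. [folklore] -/
instance (γ : ZMod 3 → ZMod 8) (c c' : Fin 3 × Fin 3) (φ φ' : ℤ) : Decidable (cd.PairBar γ c c' φ φ') := by
  unfold PairBar; infer_instance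

/-- **The class check.** [folklore] -/
def ClassOK (γ : ZMod 3 → ZMod 8) : Prop :=
  0 < cd.m ^ 2 - cd.m * cd.n + cd.n ^ 2 ∧ cd.m ^ 2 - cd.m * cd.n + cd.n ^ 2 ≤ 4 ∧ cd.t ≠ 0 ∧
    (∀ c, ∀ φ ∈ cd.P c, 0 ≤ φ ∧ φ < 8) ∧
    (∀ c c', c ≠ c' → Sred cd.t cd.m cd.n c c' ≤ 3) ∧
    (∀ c c', c ≠ c' → ∀ φ ∈ cd.P c, ∀ φ' ∈ cd.P c', cd.PairBar γ c c' φ φ') ∧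
    ((cd.MIS = 16 ∧ cd.SigT ≤ 24) ∨ (cd.MIS = 17 ∧ cd.SigT ≤ 29))

/-- The class check is decidable. [folklore] -/
instance (γ : ZMod 3 → ZMod 8) : Decidable (cd.ClassOK γ) := by
  unfold ClassOK; infer_instance

end ClassData

end PhaseArcs

end Summit.MatrixMultiplication.OmegaCensus
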